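import Mathlib
import HarnessLib
import Summits.ValiantsHypothesis.ValiantsHypothesis.Theorems.LacunarySymmetroidMatrixDescartesProductPlusOneMidSwitching
import Summits.ValiantsHypothesis.ValiantsHypothesis.Theorems.LacunarySymmetroidMatrixDescartesZeroChangeConcavityBudget

/-!
# ValiantsHypothesis / LacunarySymmetroid — crux `MatrixDescartes` (stmt-ValiantsHypothesis-18050, V1),
# LINE (A) «product_plus_one», floor `OneChangeFloorK3`: a riser pushes up in a SINGLE EPISODE (every support ratio)

Sequel of ✓ `…ProductPlusOneMidSwitching` (riser floor, entry horizon, mid-switching sector).  Setting: chart `g = a + b x^p + c x^q`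
(`p = e+1`, `q = e+k+2`), `S = p b + q c x^{q−p}`, bottom-weight summand `Ψ_j = S/g` with `Ψ_j′ = num/g²`,
`num = S′g − S g′` (✓ `hasDerivAt_term`, ✓ `psi_numerator_eq`); the zeros of `Σ_j Ψ_j` off the factors' zeros are the positive zeros of
`eulerNumerator d a 0`, and a row PUSHES UP (towards extra critical points) exactly where `num > 0` (possible only for a switched incoherent row
inside its balance zone, ✓ `…ExactZone`, born before its entry horizon, ✓ `…MidSwitching`).  This file:

* `numDeriv_identity` (pure algebra): with `x·num′` written subtraction-free,
  `S·(x·num′) = p·g·S′·((q−2p)b − q c x^{q−p}) + ((p−1)S + xS′)·num`;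
* `hasDerivAt_num` — calculus wiring of `num′ = S″g − S g″`;
* ★ `numDeriv_sign_at_crit` — at a point where `num = 0`, for a switched incoherent row, `num′` has the SIGN of
  `(q−2p)·bc − q·c²·x^{q−p}`: positive below the entry horizon `X†` (`q|c|X†^{q−p} = (q−2p)|b|`), negative above it
  (logistic reading: at `φ = K − p` one has `θ(K − p − φ) ∝ (q − p − K)`);
* ★★ `num_nonneg_ordConnected_pos` / `num_nonneg_ordConnected` — THE SINGLE-EPISODE LAW: on a switched segment of an incoherent no-dip row the
  set `{num ≥ 0}` is ORDER-CONNECTED: `num(x₁) ≥ 0`, `num(x₂) ≥ 0`, `x₁ ≤ t ≤ x₂` ⇒ `num(t) ≥ 0`.  So every riser has AT MOST ONE pushing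
  episode `[s_j, e_j]` (containing `X†_j` when non-degenerate); before `s_j` and after `e_j` it is `Ψ`-monotone for good.  Proof: the last point
  `z₁ ≤ t` of `{num ≥ 0}` has `num′(z₁) ≤ 0 ⇒ z₁ ≥ X†`, the first point `z₂ ≥ t` has `num′(z₂) ≥ 0 ⇒ z₂ ≤ X†`, contradiction with `z₁ < t < z₂`.

Use (the floor's missing global budget, paper): local minima of `Ψ = Σ_jΨ_j` (the up-crossings' precursors) lie in `⋃_j [s_j, e_j]`, ONE interval
per early riser — the natural unit for a charging argument.
HONEST FRAMING: a row law; closes NO stub; NOT `OneChangeFloorK3` / `stub_eulerBoundK3` / `stub_classRowK3` / `stub_polyLaw` / `MatrixDescartes`;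
`VP ≠ VNP` is NOT proved.  No definitions, no named facts, no sorry; Mathlib + the lane files.

[folklore] Product rule, second-derivative test and a sup/inf argument; no citation needed.
-/

set_option linter.dupNamespace false

namespace Summit.ValiantsHypothesis.ValiantsHypothesis.Theorems.LacunarySymmetroidMatrixDescartes

namespace ProductPlusOne

open Set

/-! ### §1 Algebra: `x·num′` and its sign at a critical point -/

/-- **The `x·num′` identity** (pure algebra, subtraction-free closed form of `x·num′ = x·(S″g − S g″)`):
`S·(x·num′) = p·g·S′·((q−2p)b − q c x^{q−p}) + ((p−1)S + x S′)·num`. [folklore] -/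
theorem numDeriv_identity (a b c : ℝ) (e k : ℕ) (x : ℝ) :
    ((e + 1 : ℝ) * b + (e + k + 2 : ℝ) * c * x ^ (k + 1))
        * (((e + k + 2 : ℝ) * c * ((k + 1 : ℝ) * ((k : ℝ) * x ^ k))) * (a + b * x ^ (e + 1) + c * x ^ (e + k + 2))
          - ((e + 1 : ℝ) * b + (e + k + 2 : ℝ) * c * x ^ (k + 1))
            * (b * ((e + 1 : ℝ) * ((e : ℝ) * x ^ e)) + c * ((e + k + 2 : ℝ) * ((e + k + 1 : ℝ) * x ^ (e + k + 1)))))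
      = (e + 1 : ℝ) * (a + b * x ^ (e + 1) + c * x ^ (e + k + 2)) * ((e + k + 2 : ℝ) * c * ((k + 1 : ℝ) * x ^ k))
          * (((e + k + 2 : ℝ) - 2 * (e + 1 : ℝ)) * b - (e + k + 2 : ℝ) * c * x ^ (k + 1))
        + ((e : ℝ) * ((e + 1 : ℝ) * b + (e + k + 2 : ℝ) * c * x ^ (k + 1)) + x * ((e + k + 2 : ℝ) * c * ((k + 1 : ℝ) * x ^ k)))
          * (((e + k + 2 : ℝ) * c * ((k + 1 : ℝ) * x ^ k)) * (a + b * x ^ (e + 1) + c * x ^ (e + k + 2))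
            - ((e + 1 : ℝ) * b + (e + k + 2 : ℝ) * c * x ^ (k + 1))
              * (b * ((e + 1 : ℝ) * x ^ e) + c * ((e + k + 2 : ℝ) * x ^ (e + k + 1)))) := by
  ring

/-- **Calculus wiring of `num′`**: the numerator `num(y) = S′(y)g(y) − S(y)g′(y)` has derivative `S″g − S g″`. [folklore] -/
theorem hasDerivAt_num (a b c : ℝ) (e k : ℕ) (x : ℝ) :
    HasDerivAt (fun y : ℝ => ((e + k + 2 : ℝ) * c * ((k + 1 : ℝ) * y ^ k)) * (a + b * y ^ (e + 1) + c * y ^ (e + k + 2))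
        - ((e + 1 : ℝ) * b + (e + k + 2 : ℝ) * c * y ^ (k + 1))
          * (b * ((e + 1 : ℝ) * y ^ e) + c * ((e + k + 2 : ℝ) * y ^ (e + k + 1))))
      (((e + k + 2 : ℝ) * c * ((k + 1 : ℝ) * ((k : ℝ) * x ^ (k - 1)))) * (a + b * x ^ (e + 1) + c * x ^ (e + k + 2))
        + ((e + k + 2 : ℝ) * c * ((k + 1 : ℝ) * x ^ k)) * (b * ((e + 1 : ℝ) * x ^ e) + c * ((e + k + 2 : ℝ) * x ^ (e + k + 1)))
        - (((e + k + 2 : ℝ) * c * ((k + 1 : ℝ) * x ^ k)) * (b * ((e + 1 : ℝ) * x ^ e) + c * ((e + k + 2 : ℝ) * x ^ (e + k + 1)))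
          + ((e + 1 : ℝ) * b + (e + k + 2 : ℝ) * c * x ^ (k + 1))
            * (b * ((e + 1 : ℝ) * ((e : ℝ) * x ^ (e - 1))) + c * ((e + k + 2 : ℝ) * ((e + k + 1 : ℝ) * x ^ (e + k)))))) x := by
  have hS : HasDerivAt (fun y : ℝ => (e + 1 : ℝ) * b + (e + k + 2 : ℝ) * c * y ^ (k + 1))
      ((e + k + 2 : ℝ) * c * ((k + 1 : ℝ) * x ^ k)) x := by
    have h := ((hasDerivAt_pow (k + 1) x).const_mul ((e + k + 2 : ℝ) * c)).const_add ((e + 1 : ℝ) * b)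
    refine h.congr_deriv ?_
    push_cast; simp
  have hS' : HasDerivAt (fun y : ℝ => (e + k + 2 : ℝ) * c * ((k + 1 : ℝ) * y ^ k))
      ((e + k + 2 : ℝ) * c * ((k + 1 : ℝ) * ((k : ℝ) * x ^ (k - 1)))) x :=
    ((hasDerivAt_pow k x).const_mul (k + 1 : ℝ)).const_mul ((e + k + 2 : ℝ) * c)
  have hg : HasDerivAt (fun y : ℝ => a + b * y ^ (e + 1) + c * y ^ (e + k + 2))
      (b * ((e + 1 : ℝ) * x ^ e) + c * ((e + k + 2 : ℝ) * x ^ (e + k + 1))) x := by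
    have h1 := ((hasDerivAt_pow (e + 1) x).const_mul b).const_add a
    have h2 := (hasDerivAt_pow (e + k + 2) x).const_mul c
    refine (h1.add h2).congr_deriv ?_
    push_cast; simp [add_assoc]
  have hg' : HasDerivAt (fun y : ℝ => b * ((e + 1 : ℝ) * y ^ e) + c * ((e + k + 2 : ℝ) * y ^ (e + k + 1)))
      (b * ((e + 1 : ℝ) * ((e : ℝ) * x ^ (e - 1))) + c * ((e + k + 2 : ℝ) * ((e + k + 1 : ℝ) * x ^ (e + k)))) x := by
    have h1 := ((hasDerivAt_pow e x).const_mul (e + 1 : ℝ)).const_mul b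
    have h2 := ((hasDerivAt_pow (e + k + 1) x).const_mul (e + k + 2 : ℝ)).const_mul c
    refine (h1.add h2).congr_deriv ?_
    push_cast; simp
  exact (hS'.mul hg).sub (hS.mul hg')

/-- ★ **Sign of `num′` at a critical point** (normalised signs `b < 0`, `c < 0`, switched `g(x) < 0`, `x > 0`, `num(x) = 0`): if `num′ = D`
there, then `S·x·D = p·(g·S′)·E′` with `E′ = (q−2p)b − q c x^{q−p}`, so `D` has the sign of `(q−2p)·bc − q·c²·x^{q−p}`
(the two one-sided implications). [this file's lemma] -/
theorem numDeriv_sign_at_crit (a b c : ℝ) (e k : ℕ) (hb : b < 0) (hc : c < 0) {x : ℝ} (hx : 0 < x)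
    (hsw : a + b * x ^ (e + 1) + c * x ^ (e + k + 2) < 0)
    (hcrit : ((e + k + 2 : ℝ) * c * ((k + 1 : ℝ) * x ^ k)) * (a + b * x ^ (e + 1) + c * x ^ (e + k + 2))
        - ((e + 1 : ℝ) * b + (e + k + 2 : ℝ) * c * x ^ (k + 1))
          * (b * ((e + 1 : ℝ) * x ^ e) + c * ((e + k + 2 : ℝ) * x ^ (e + k + 1))) = 0)
    {D : ℝ} (hD : HasDerivAt (fun y : ℝ => ((e + k + 2 : ℝ) * c * ((k + 1 : ℝ) * y ^ k)) * (a + b * y ^ (e + 1) + c * y ^ (e + k + 2))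
        - ((e + 1 : ℝ) * b + (e + k + 2 : ℝ) * c * y ^ (k + 1))
          * (b * ((e + 1 : ℝ) * y ^ e) + c * ((e + k + 2 : ℝ) * y ^ (e + k + 1)))) D x) :
    (D ≤ 0 → ((e + k + 2 : ℝ) - 2 * (e + 1 : ℝ)) * (b * c) ≤ (e + k + 2 : ℝ) * c ^ 2 * x ^ (k + 1)) ∧
    (0 ≤ D → (e + k + 2 : ℝ) * c ^ 2 * x ^ (k + 1) ≤ ((e + k + 2 : ℝ) - 2 * (e + 1 : ℝ)) * (b * c)) := by
  have hDval := (hasDerivAt_num a b c e k x).unique hD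
  -- `x·D` in subtraction-free form
  have h1 : x * ((k : ℝ) * x ^ (k - 1)) = (k : ℝ) * x ^ k := by
    cases k with
    | zero => simp
    | succ n => rw [Nat.add_sub_cancel, pow_succ]; ring
  have h2 : x * ((e : ℝ) * x ^ (e - 1)) = (e : ℝ) * x ^ e := by
    cases e with
    | zero => simp
    | succ n => rw [Nat.add_sub_cancel, pow_succ]; ring
  have h3 : x * x ^ (e + k) = x ^ (e + k + 1) := by rw [pow_succ]; ring
  have hxD : x * D = ((e + k + 2 : ℝ) * c * ((k + 1 : ℝ) * ((k : ℝ) * x ^ k))) * (a + b * x ^ (e + 1) + c * x ^ (e + k + 2))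
      - ((e + 1 : ℝ) * b + (e + k + 2 : ℝ) * c * x ^ (k + 1))
        * (b * ((e + 1 : ℝ) * ((e : ℝ) * x ^ e)) + c * ((e + k + 2 : ℝ) * ((e + k + 1 : ℝ) * x ^ (e + k + 1)))) := by
    rw [← hDval]
    have expand : x * (((e + k + 2 : ℝ) * c * ((k + 1 : ℝ) * ((k : ℝ) * x ^ (k - 1)))) * (a + b * x ^ (e + 1) + c * x ^ (e + k + 2))
        + ((e + k + 2 : ℝ) * c * ((k + 1 : ℝ) * x ^ k)) * (b * ((e + 1 : ℝ) * x ^ e) + c * ((e + k + 2 : ℝ) * x ^ (e + k + 1)))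
        - (((e + k + 2 : ℝ) * c * ((k + 1 : ℝ) * x ^ k)) * (b * ((e + 1 : ℝ) * x ^ e) + c * ((e + k + 2 : ℝ) * x ^ (e + k + 1)))
          + ((e + 1 : ℝ) * b + (e + k + 2 : ℝ) * c * x ^ (k + 1))
            * (b * ((e + 1 : ℝ) * ((e : ℝ) * x ^ (e - 1))) + c * ((e + k + 2 : ℝ) * ((e + k + 1 : ℝ) * x ^ (e + k))))))
      = ((e + k + 2 : ℝ) * c * ((k + 1 : ℝ) * (x * ((k : ℝ) * x ^ (k - 1))))) * (a + b * x ^ (e + 1) + c * x ^ (e + k + 2))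
        - ((e + 1 : ℝ) * b + (e + k + 2 : ℝ) * c * x ^ (k + 1))
          * (b * ((e + 1 : ℝ) * (x * ((e : ℝ) * x ^ (e - 1)))) + c * ((e + k + 2 : ℝ) * ((e + k + 1 : ℝ) * (x * x ^ (e + k))))) := by
      ring
    rw [expand, h1, h2, h3]
  -- the identity at the critical point: `S·(x·D) = p·g·S′·E′`
  set g := a + b * x ^ (e + 1) + c * x ^ (e + k + 2) with hgdef
  set S := (e + 1 : ℝ) * b + (e + k + 2 : ℝ) * c * x ^ (k + 1) with hSdef
  set S' := (e + k + 2 : ℝ) * c * ((k + 1 : ℝ) * x ^ k) with hS'def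
  set E' := ((e + k + 2 : ℝ) - 2 * (e + 1 : ℝ)) * b - (e + k + 2 : ℝ) * c * x ^ (k + 1) with hE'def
  have hid := numDeriv_identity a b c e k x
  rw [← hxD, hcrit, mul_zero, add_zero] at hid
  -- signs
  have hxk : 0 < x ^ (k + 1) := pow_pos hx _
  have hS : S < 0 := by rw [hSdef]; nlinarith [mul_pos_of_neg_of_neg hc (neg_neg_of_pos hxk)]
  have hS'neg : S' < 0 := by
    rw [hS'def]
    exact mul_neg_of_neg_of_pos (mul_neg_of_pos_of_neg (by positivity) hc) (by positivity)
  have hgS' : 0 < g * S' := mul_pos_of_neg_of_neg hsw hS'neg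
  have hcE' : c * E' = ((e + k + 2 : ℝ) - 2 * (e + 1 : ℝ)) * (b * c) - (e + k + 2 : ℝ) * c ^ 2 * x ^ (k + 1) := by
    rw [hE'def]; ring
  have hkey : S * x * D = (e + 1 : ℝ) * (g * S') * E' := by
    have : S * (x * D) = (e + 1 : ℝ) * g * S' * E' := hid
    rw [← mul_assoc] at this; rw [this]; ring
  have hSx : S * x < 0 := mul_neg_of_neg_of_pos hS hx
  have hcoef : 0 < (e + 1 : ℝ) * (g * S') := mul_pos (by positivity) hgS'
  constructor
  · intro hD0
    have h1 : 0 ≤ S * x * D := mul_nonneg_of_nonpos_of_nonpos hSx.le hD0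
    rw [hkey] at h1
    have hE'0 : 0 ≤ E' := by
      by_contra hv
      have := mul_neg_of_pos_of_neg hcoef (lt_of_not_ge hv)
      linarith
    have : c * E' ≤ 0 := mul_nonpos_of_nonpos_of_nonneg hc.le hE'0
    rw [hcE'] at this; linarith
  · intro hD0
    have h1 : S * x * D ≤ 0 := mul_nonpos_of_nonpos_of_nonneg hSx.le hD0
    rw [hkey] at h1
    have hE'0 : E' ≤ 0 := by
      by_contra hpos
      have := mul_pos hcoef (lt_of_not_ge hpos)
      linarith
    have : 0 ≤ c * E' := mul_nonneg_of_nonpos_of_nonpos hc.le hE'0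
    rw [hcE'] at this; linarith

/-! ### §2 The single-episode law -/

/-- ★★ **SINGLE-EPISODE LAW** (normalised signs `b < 0`, `c < 0`): on a segment `[x₁, x₂] ⊂ (0,∞)` on which the row is switched (`g < 0`),
`num(x₁) ≥ 0` and `num(x₂) ≥ 0` force `num(t) ≥ 0` for every `t ∈ [x₁, x₂]` — the pushing set `{num ≥ 0}` of a riser is an interval.
[this file's theorem] -/
theorem num_nonneg_ordConnected_pos (a b c : ℝ) (e k : ℕ) (hb : b < 0) (hc : c < 0) {x₁ x₂ t : ℝ} (hx₁ : 0 < x₁)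
    (h1t : x₁ ≤ t) (ht2 : t ≤ x₂)
    (hsw : ∀ x ∈ Icc x₁ x₂, a + b * x ^ (e + 1) + c * x ^ (e + k + 2) < 0)
    (hn1 : 0 ≤ ((e + k + 2 : ℝ) * c * ((k + 1 : ℝ) * x₁ ^ k)) * (a + b * x₁ ^ (e + 1) + c * x₁ ^ (e + k + 2))
        - ((e + 1 : ℝ) * b + (e + k + 2 : ℝ) * c * x₁ ^ (k + 1))
          * (b * ((e + 1 : ℝ) * x₁ ^ e) + c * ((e + k + 2 : ℝ) * x₁ ^ (e + k + 1))))
    (hn2 : 0 ≤ ((e + k + 2 : ℝ) * c * ((k + 1 : ℝ) * x₂ ^ k)) * (a + b * x₂ ^ (e + 1) + c * x₂ ^ (e + k + 2))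
        - ((e + 1 : ℝ) * b + (e + k + 2 : ℝ) * c * x₂ ^ (k + 1))
          * (b * ((e + 1 : ℝ) * x₂ ^ e) + c * ((e + k + 2 : ℝ) * x₂ ^ (e + k + 1)))) :
    0 ≤ ((e + k + 2 : ℝ) * c * ((k + 1 : ℝ) * t ^ k)) * (a + b * t ^ (e + 1) + c * t ^ (e + k + 2))
        - ((e + 1 : ℝ) * b + (e + k + 2 : ℝ) * c * t ^ (k + 1))
          * (b * ((e + 1 : ℝ) * t ^ e) + c * ((e + k + 2 : ℝ) * t ^ (e + k + 1))) := by
  set num : ℝ → ℝ := fun y => ((e + k + 2 : ℝ) * c * ((k + 1 : ℝ) * y ^ k)) * (a + b * y ^ (e + 1) + c * y ^ (e + k + 2))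
        - ((e + 1 : ℝ) * b + (e + k + 2 : ℝ) * c * y ^ (k + 1))
          * (b * ((e + 1 : ℝ) * y ^ e) + c * ((e + k + 2 : ℝ) * y ^ (e + k + 1))) with hnumdef
  change 0 ≤ num t
  have hn1' : 0 ≤ num x₁ := hn1
  have hn2' : 0 ≤ num x₂ := hn2
  have hcont : Continuous num := by rw [hnumdef]; fun_prop
  by_contra hneg
  have hnt : num t < 0 := lt_of_not_ge hneg
  have h1t' : x₁ < t := lt_of_le_of_ne h1t (by rintro rfl; exact absurd hn1' hneg)
  have ht2' : t < x₂ := lt_of_le_of_ne ht2 (by rintro rfl; exact absurd hn2' hneg)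
  have hc2 : 0 < c ^ 2 := by rw [sq]; exact mul_pos_of_neg_of_neg hc hc
  have hq : (0 : ℝ) < (e + k + 2 : ℝ) * c ^ 2 := mul_pos (by positivity) hc2
  ---- the last point `z₁` of `{num ≥ 0}` in `[x₁, t]`
  set A := Icc x₁ t ∩ {x | 0 ≤ num x} with hA
  have hAcl : IsClosed A := isClosed_Icc.inter (isClosed_le continuous_const hcont)
  have hAbdd : BddAbove A := (bddAbove_Icc).mono inter_subset_left
  have hAne : A.Nonempty := ⟨x₁, ⟨le_rfl, h1t⟩, hn1'⟩
  set z₁ := sSup A with hz₁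
  have hz₁A : z₁ ∈ A := hAcl.csSup_mem hAne hAbdd
  have hz₁num : 0 ≤ num z₁ := hz₁A.2
  have hz₁t : z₁ < t := lt_of_le_of_ne hz₁A.1.2 (by intro h; rw [h] at hz₁num; exact absurd hz₁num hneg)
  have hright₁ : ∀ x, z₁ < x → x ≤ t → num x < 0 := by
    intro x hzx hxt
    by_contra hge
    have hxA : x ∈ A := ⟨⟨hz₁A.1.1.trans hzx.le, hxt⟩, le_of_not_gt hge⟩
    exact absurd (le_csSup hAbdd hxA) (not_le.2 hzx)
  have hz₁zero : num z₁ = 0 := by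
    refine le_antisymm ?_ hz₁num
    by_contra hpos
    have hpos' : 0 < num z₁ := lt_of_not_ge hpos
    obtain ⟨δ, hδ, hδ'⟩ := Metric.continuousAt_iff.1 hcont.continuousAt (num z₁ / 2) (by linarith)
    have hzx : z₁ < min (z₁ + δ / 2) t := lt_min (by linarith) hz₁t
    have hxd : dist (min (z₁ + δ / 2) t) z₁ < δ := by
      rw [Real.dist_eq, abs_of_pos (by linarith)]
      linarith [min_le_left (z₁ + δ / 2) t]
    have h := hδ' hxd
    rw [Real.dist_eq] at h
    have := hright₁ _ hzx (min_le_right _ _)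
    linarith [(abs_lt.1 h).1]
  ---- the first point `z₂` of `{num ≥ 0}` in `[t, x₂]`
  set B := Icc t x₂ ∩ {x | 0 ≤ num x} with hB
  have hBcl : IsClosed B := isClosed_Icc.inter (isClosed_le continuous_const hcont)
  have hBbdd : BddBelow B := (bddBelow_Icc).mono inter_subset_left
  have hBne : B.Nonempty := ⟨x₂, ⟨ht2, le_rfl⟩, hn2'⟩
  set z₂ := sInf B with hz₂
  have hz₂B : z₂ ∈ B := hBcl.csInf_mem hBne hBbdd
  have hz₂num : 0 ≤ num z₂ := hz₂B.2
  have htz₂ : t < z₂ := lt_of_le_of_ne hz₂B.1.1 (by intro h; rw [← h] at hz₂num; exact absurd hz₂num hneg)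
  have hleft₂ : ∀ x, t ≤ x → x < z₂ → num x < 0 := by
    intro x htx hxz
    by_contra hge
    have hxB : x ∈ B := ⟨⟨htx, hxz.le.trans hz₂B.1.2⟩, le_of_not_gt hge⟩
    exact absurd (csInf_le hBbdd hxB) (not_le.2 hxz)
  have hz₂zero : num z₂ = 0 := by
    refine le_antisymm ?_ hz₂num
    by_contra hpos
    have hpos' : 0 < num z₂ := lt_of_not_ge hpos
    obtain ⟨δ, hδ, hδ'⟩ := Metric.continuousAt_iff.1 hcont.continuousAt (num z₂ / 2) (by linarith)
    have hxz : max (z₂ - δ / 2) t < z₂ := max_lt (by linarith) htz₂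
    have hxd : dist (max (z₂ - δ / 2) t) z₂ < δ := by
      rw [Real.dist_eq, abs_of_neg (by linarith)]
      linarith [le_max_left (z₂ - δ / 2) t]
    have h := hδ' hxd
    rw [Real.dist_eq] at h
    have := hleft₂ _ (le_max_right _ _) hxz
    linarith [(abs_lt.1 h).1]
  ---- derivative signs at `z₁`, `z₂`
  have hz₁pos : 0 < z₁ := hx₁.trans_le hz₁A.1.1
  have hz₂pos : 0 < z₂ := hx₁.trans_le (h1t.trans hz₂B.1.1)
  have hz₁I : z₁ ∈ Icc x₁ x₂ := ⟨hz₁A.1.1, hz₁t.le.trans ht2⟩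
  have hz₂I : z₂ ∈ Icc x₁ x₂ := ⟨h1t.trans hz₂B.1.1, hz₂B.1.2⟩
  have hD₁ := hasDerivAt_num a b c e k z₁
  have hD₂ := hasDerivAt_num a b c e k z₂
  set D₁ := ((e + k + 2 : ℝ) * c * ((k + 1 : ℝ) * ((k : ℝ) * z₁ ^ (k - 1)))) * (a + b * z₁ ^ (e + 1) + c * z₁ ^ (e + k + 2))
        + ((e + k + 2 : ℝ) * c * ((k + 1 : ℝ) * z₁ ^ k)) * (b * ((e + 1 : ℝ) * z₁ ^ e) + c * ((e + k + 2 : ℝ) * z₁ ^ (e + k + 1)))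
        - (((e + k + 2 : ℝ) * c * ((k + 1 : ℝ) * z₁ ^ k)) * (b * ((e + 1 : ℝ) * z₁ ^ e) + c * ((e + k + 2 : ℝ) * z₁ ^ (e + k + 1)))
          + ((e + 1 : ℝ) * b + (e + k + 2 : ℝ) * c * z₁ ^ (k + 1))
            * (b * ((e + 1 : ℝ) * ((e : ℝ) * z₁ ^ (e - 1))) + c * ((e + k + 2 : ℝ) * ((e + k + 1 : ℝ) * z₁ ^ (e + k))))) with hD₁def
  set D₂ := ((e + k + 2 : ℝ) * c * ((k + 1 : ℝ) * ((k : ℝ) * z₂ ^ (k - 1)))) * (a + b * z₂ ^ (e + 1) + c * z₂ ^ (e + k + 2))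
        + ((e + k + 2 : ℝ) * c * ((k + 1 : ℝ) * z₂ ^ k)) * (b * ((e + 1 : ℝ) * z₂ ^ e) + c * ((e + k + 2 : ℝ) * z₂ ^ (e + k + 1)))
        - (((e + k + 2 : ℝ) * c * ((k + 1 : ℝ) * z₂ ^ k)) * (b * ((e + 1 : ℝ) * z₂ ^ e) + c * ((e + k + 2 : ℝ) * z₂ ^ (e + k + 1)))
          + ((e + 1 : ℝ) * b + (e + k + 2 : ℝ) * c * z₂ ^ (k + 1))
            * (b * ((e + 1 : ℝ) * ((e : ℝ) * z₂ ^ (e - 1))) + c * ((e + k + 2 : ℝ) * ((e + k + 1 : ℝ) * z₂ ^ (e + k))))) with hD₂def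
  -- `D₁ ≤ 0`: otherwise `num > 0` just right of `z₁`
  have hD₁le : D₁ ≤ 0 := by
    by_contra hpos
    have hpos' : 0 < D₁ := lt_of_not_ge hpos
    obtain ⟨δ, hδ, hδ'⟩ :=
      ZeroChange.neg_right_of_hasDerivAt_neg hD₁.neg (by change -num z₁ = 0; rw [hz₁zero, neg_zero]) (neg_neg_of_pos hpos')
    have hzx : z₁ < min (z₁ + δ / 2) t := lt_min (by linarith) hz₁t
    have h := hδ' _ hzx (lt_of_le_of_lt (min_le_left _ _) (by linarith))
    have h' : 0 < num (min (z₁ + δ / 2) t) := by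
      change -num (min (z₁ + δ / 2) t) < 0 at h
      linarith
    have := hright₁ _ hzx (min_le_right _ _)
    linarith
  -- `D₂ ≥ 0`: otherwise `num > 0` just left of `z₂`
  have hD₂ge : 0 ≤ D₂ := by
    by_contra hneg'
    obtain ⟨δ, hδ, hδ'⟩ := ZeroChange.pos_left_of_hasDerivAt_neg hD₂ hz₂zero (lt_of_not_ge hneg')
    have hxz : max (z₂ - δ / 2) t < z₂ := max_lt (by linarith) htz₂
    have h := hδ' _ (lt_of_lt_of_le (by linarith) (le_max_left _ _)) hxz
    have h' : 0 < num (max (z₂ - δ / 2) t) := h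
    have := hleft₂ _ (le_max_right _ _) hxz
    linarith
  -- thresholds: `z₁ ≥ X†`, `z₂ ≤ X†`, but `z₁ < z₂`
  have hT₁ := (numDeriv_sign_at_crit a b c e k hb hc hz₁pos (hsw z₁ hz₁I) hz₁zero hD₁).1 hD₁le
  have hT₂ := (numDeriv_sign_at_crit a b c e k hb hc hz₂pos (hsw z₂ hz₂I) hz₂zero hD₂).2 hD₂ge
  have hzz : z₁ < z₂ := hz₁t.trans htz₂
  have hpow : z₁ ^ (k + 1) < z₂ ^ (k + 1) := pow_lt_pow_left₀ hzz hz₁pos.le (Nat.succ_ne_zero k)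
  have := mul_lt_mul_of_pos_left hpow hq
  linarith

/-- ★★ **SINGLE-EPISODE LAW, sign-free**: an incoherent no-dip row (`a b < 0`, `a c < 0`) switched on `[x₁, x₂] ⊂ (0,∞)` (`c·g > 0` there)
with `num(x₁) ≥ 0` and `num(x₂) ≥ 0` has `num(t) ≥ 0` at every `t ∈ [x₁, x₂]`. [this file's theorem] -/
theorem num_nonneg_ordConnected (a b c : ℝ) (e k : ℕ) (hab : a * b < 0) (hac : a * c < 0) {x₁ x₂ t : ℝ} (hx₁ : 0 < x₁)
    (h1t : x₁ ≤ t) (ht2 : t ≤ x₂)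
    (hsw : ∀ x ∈ Icc x₁ x₂, 0 < c * (a + b * x ^ (e + 1) + c * x ^ (e + k + 2)))
    (hn1 : 0 ≤ ((e + k + 2 : ℝ) * c * ((k + 1 : ℝ) * x₁ ^ k)) * (a + b * x₁ ^ (e + 1) + c * x₁ ^ (e + k + 2))
        - ((e + 1 : ℝ) * b + (e + k + 2 : ℝ) * c * x₁ ^ (k + 1))
          * (b * ((e + 1 : ℝ) * x₁ ^ e) + c * ((e + k + 2 : ℝ) * x₁ ^ (e + k + 1))))
    (hn2 : 0 ≤ ((e + k + 2 : ℝ) * c * ((k + 1 : ℝ) * x₂ ^ k)) * (a + b * x₂ ^ (e + 1) + c * x₂ ^ (e + k + 2))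
        - ((e + 1 : ℝ) * b + (e + k + 2 : ℝ) * c * x₂ ^ (k + 1))
          * (b * ((e + 1 : ℝ) * x₂ ^ e) + c * ((e + k + 2 : ℝ) * x₂ ^ (e + k + 1)))) :
    0 ≤ ((e + k + 2 : ℝ) * c * ((k + 1 : ℝ) * t ^ k)) * (a + b * t ^ (e + 1) + c * t ^ (e + k + 2))
        - ((e + 1 : ℝ) * b + (e + k + 2 : ℝ) * c * t ^ (k + 1))
          * (b * ((e + 1 : ℝ) * t ^ e) + c * ((e + k + 2 : ℝ) * t ^ (e + k + 1))) := by
  rcases lt_or_gt_of_ne (show a ≠ 0 by rintro rfl; simp at hab) with ha | ha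
  · -- `a < 0 < b, c`: flip all signs (`num` is invariant, ✓ `numerator_neg_flip`)
    have hb : 0 < b := by nlinarith
    have hc : 0 < c := by nlinarith
    have hsw' : ∀ x ∈ Icc x₁ x₂, -a + -b * x ^ (e + 1) + -c * x ^ (e + k + 2) < 0 := by
      intro x hx
      have : 0 < a + b * x ^ (e + 1) + c * x ^ (e + k + 2) := pos_of_mul_pos_right (hsw x hx) hc.le
      linarith
    have h := num_nonneg_ordConnected_pos (-a) (-b) (-c) e k (neg_neg_of_pos hb) (neg_neg_of_pos hc) hx₁ h1t ht2 hsw'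
      (by rw [numerator_neg_flip]; exact hn1) (by rw [numerator_neg_flip]; exact hn2)
    rwa [numerator_neg_flip] at h
  · have hb : b < 0 := by nlinarith
    have hc : c < 0 := by nlinarith
    have hsw' : ∀ x ∈ Icc x₁ x₂, a + b * x ^ (e + 1) + c * x ^ (e + k + 2) < 0 := by
      intro x hx
      by_contra hge
      have := mul_nonpos_of_nonpos_of_nonneg hc.le (le_of_not_gt hge)
      linarith [hsw x hx]
    exact num_nonneg_ordConnected_pos a b c e k hb hc hx₁ h1t ht2 hsw' hn1 hn2

end ProductPlusOne

end Summit.ValiantsHypothesis.ValiantsHypothesis.Theorems.LacunarySymmetroidMatrixDescartes
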